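import Summits.Ventures.CertifiedManyBodySolver.Theorems.TcThermcert1FreeGasTwistedTrace
import Summits.Ventures.CertifiedManyBodySolver.Theorems.TcThermcert1FreeGasPinningInputs
import Literature.MathematicalPhysics.QuantumLattice.MagneticHubbardTorusTrivialField
import Literature.MathematicalPhysics.QuantumLattice.MagneticHubbardTorusTwistBound
import HarnessLib

/-!
# Free canonical gas at `β·t = 8` — S2 in operator form: the two-fugacity twisted trace of the free torus and its Gaussian domination

Helper file for route `TcThermcert1` (crux K1′ `ThermalStiffnessCeilingU8b8_le_7o44`, item `stmt-Ventures-24560`), crux idea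
`free-canonical-b8-rung` (sketch `Cruxes/ThermalStiffnessCeilingU8b10_le_1o8/FreeCanonicalB8Sketch.lean`, first lemma S2
`fugacityCircle_domination` = the tree's `FreeGasArc.Inputs.offArcGaussianDecay_holds`, a SCALAR product inequality).

This file puts S2 on the actual operator of the line: for the flux-free `t`-torus `hubbardTorusTT'Flux L 0 0 0` (`L ≥ 3`) and all
NON-ZERO complex fugacities `z, w`,

  `tr( diag(z^{N↑} w^{N↓}) e^{−βH₀} ) = ∏_k (1 + z κ_k)(1 + w κ_k)`,  `κ_k = e^{−β ε_k}`, `ε_k = −2(cos k₁ + cos k₂)` (§2),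

(the tree's spin-twisted trace formula `FreeGasArc.trace_exp_spinTwist_mul_gibbsWeight_dGamma_twistedOneBody` at twist `0`, with
`e^{Σ_σ f_σ N_σ} = diag(z^{N↑} w^{N↓})` for `f = (log z, log w)` and `H₀ = dΓ(twistedOneBody L 0 0)` via the trivial gauge field, §1),
and hence the **two-fugacity Gaussian domination** (§3): on the torus `z = r e^{iφ}`, `w = r' e^{iψ}` (`r, r' > 0`)

  `|Ξ(z, w)| ≤ Ξ(r, r') · exp(−(1 − cos φ) σ_r²) · exp(−(1 − cos ψ) σ_{r'}²)`,  `σ_r² = Σ_k r κ_k/(1 + r κ_k)²`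

— the bad arcs cost the GLOBAL number variance. NOT here: anything with an insertion (S6).

HONEST LABEL: free-fermion algebra; a step of a RUNG (`U = 0`, BC5-type witness for the C8 bet), reach at `U = 8` ZERO; decides nothing
about K1/K1′/`T_c`; superconductivity in the Hubbard model is NOT proved or advanced by this file beyond the rung.
-/

noncomputable section

namespace Summit.Ventures.CertifiedManyBodySolver.Theorems.TcThermcert1.FreeCanonicalB8

open Matrix Finset
open Literature.MathematicalPhysics.QuantumLattice
open Literature.Probability.LatticeModels (TorusSite)
open Summit.Ventures.CertifiedManyBodySolver.Theorems.FreeGasArc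

variable {L : ℕ} [NeZero L]

/-! ## §1 Model glue: `H₀ = dΓ(twistedOneBody L 0 0)` (tree: `uniformTwistConfig_zero`) and `diag(z^{N↑} w^{N↓}) = e^{(log z) N↑ + (log w) N↓}` -/

/-- **The flux-free free torus is `dΓ` of the untwisted hopping matrix**: `hubbardTorusTT'Flux L 0 0 0 = dΓ(twistedOneBody L 0 0)`
(`L ≥ 3`). -/
theorem hubbardTorusTT'Flux_free_eq_dGamma_twistedOneBody (hL : 3 ≤ L) :
    hubbardTorusTT'Flux L 0 0 0 = dGamma (twistedOneBody L ![0, 0] 0) := by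
  rw [← magneticHubbardTorus_uniformTwist_eq_dGamma, Literature.MathematicalPhysics.QuantumLattice.uniformTwistConfig_zero, magneticHubbardTorus_one_eq_hubbardTorus hL,
    hubbardTorusTT'Flux_zero, hubbardTorusTT'_zero]

omit [NeZero L] in
/-- `diag(z^{N↑} w^{N↓}) = exp((log z) N↑ + (log w) N↓)` for non-zero `z, w` (canonical instances; callers with another
`DecidableEq` instance on the occupation basis use `convert`). -/
theorem diagonal_fugacity_eq_exp_spinNumber {z w : ℂ} (hz : z ≠ 0) (hw : w ≠ 0) :
    diagonal (fun s : Finset (Orb (FermionTorus 2 L)) => z ^ (upPart s).card * w ^ (downPart s).card) =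
      NormedSpace.exp (∑ σ : Fin 2, (![Complex.log z, Complex.log w] σ) • ∑ x : FermionTorus 2 L, numberAt (orb x σ)) := by
  rw [exp_sum_smul_spinNumber_eq_diagonal_decEq]
  congr 1
  funext s
  simp only [Matrix.cons_val_zero, Matrix.cons_val_one]
  rw [Complex.exp_add, mul_comm (Complex.log z), mul_comm (Complex.log w), Complex.exp_nat_mul, Complex.exp_nat_mul,
    Complex.exp_log hz, Complex.exp_log hw]

/-! ## §2 The two-fugacity twisted trace of the free torus in closed form -/

/-- **`Ξ_L(z, w) = ∏_k (1 + z κ_k)(1 + w κ_k)`** for the flux-free free torus (`L ≥ 3`) and all non-zero complex `z, w`, with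
`κ_k = exp(−β · twistedBand L 0 0 k)` (`twistedBand L 0 0 k = −2(cos(2πk₁/L) + cos(2πk₂/L))`). -/
theorem trace_diagonal_fugacity_mul_gibbsWeight_free_eq_prod (hL : 3 ≤ L) (β : ℝ) {z w : ℂ} (hz : z ≠ 0) (hw : w ≠ 0) :
    (diagonal (fun s : Finset (Orb (FermionTorus 2 L)) => z ^ (upPart s).card * w ^ (downPart s).card) *
        gibbsWeight β (hubbardTorusTT'Flux L 0 0 0)).trace =
      ∏ k : TorusSite 2 L, ((1 + z * ((Real.exp (-(β * twistedBand L ![0, 0] 0 k)) : ℝ) : ℂ)) *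
        (1 + w * ((Real.exp (-(β * twistedBand L ![0, 0] 0 k)) : ℝ) : ℂ))) := by
  rw [diagonal_fugacity_eq_exp_spinNumber hz hw, hubbardTorusTT'Flux_free_eq_dGamma_twistedOneBody hL,
    trace_exp_spinTwist_mul_gibbsWeight_dGamma_twistedOneBody β ![0, 0] ![Complex.log z, Complex.log w]]
  refine Finset.prod_congr rfl fun k _ => ?_
  rw [Fin.prod_univ_two]
  simp only [Matrix.cons_val_zero, Matrix.cons_val_one, Complex.exp_log hz, Complex.exp_log hw]

/-! ## §3 Two-fugacity Gaussian domination of the free twisted trace -/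

/-- **S2, operator form.** On the fugacity torus `z = r e^{iφ}`, `w = r' e^{iψ}` (`r, r' > 0`), `L ≥ 3`:
`|tr(diag(z^{N↑}w^{N↓}) e^{−βH₀})| ≤ [∏_k (1 + rκ_k)(1 + r'κ_k)] · exp(−(1−cos φ) Σ_k rκ_k/(1+rκ_k)²) · exp(−(1−cos ψ) Σ_k r'κ_k/(1+r'κ_k)²)`,
the first factor being `Ξ_L(r, r') = tr(diag(r^{N↑} r'^{N↓}) e^{−βH₀})` by `trace_diagonal_fugacity_mul_gibbsWeight_free_eq_prod`. -/
theorem norm_trace_diagonal_fugacity_mul_gibbsWeight_free_le (hL : 3 ≤ L) (β : ℝ) {r r' : ℝ} (hr : 0 < r) (hr' : 0 < r')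
    (φ ψ : ℝ) :
    ‖(diagonal (fun s : Finset (Orb (FermionTorus 2 L)) =>
        ((r : ℂ) * Complex.exp (Complex.I * φ)) ^ (upPart s).card * ((r' : ℂ) * Complex.exp (Complex.I * ψ)) ^ (downPart s).card) *
        gibbsWeight β (hubbardTorusTT'Flux L 0 0 0)).trace‖ ≤
      ((∏ k : TorusSite 2 L, (1 + r * Real.exp (-(β * twistedBand L ![0, 0] 0 k)))) *
          Real.exp (-((1 - Real.cos φ) * ∑ k : TorusSite 2 L,
            r * Real.exp (-(β * twistedBand L ![0, 0] 0 k)) / (1 + r * Real.exp (-(β * twistedBand L ![0, 0] 0 k))) ^ 2))) *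
        ((∏ k : TorusSite 2 L, (1 + r' * Real.exp (-(β * twistedBand L ![0, 0] 0 k)))) *
          Real.exp (-((1 - Real.cos ψ) * ∑ k : TorusSite 2 L,
            r' * Real.exp (-(β * twistedBand L ![0, 0] 0 k)) / (1 + r' * Real.exp (-(β * twistedBand L ![0, 0] 0 k))) ^ 2))) := by
  have hz : (r : ℂ) * Complex.exp (Complex.I * φ) ≠ 0 := mul_ne_zero (Complex.ofReal_ne_zero.2 hr.ne') (Complex.exp_ne_zero _)
  have hw : (r' : ℂ) * Complex.exp (Complex.I * ψ) ≠ 0 := mul_ne_zero (Complex.ofReal_ne_zero.2 hr'.ne') (Complex.exp_ne_zero _)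
  rw [trace_diagonal_fugacity_mul_gibbsWeight_free_eq_prod hL β hz hw, Finset.prod_mul_distrib, norm_mul]
  set κ : TorusSite 2 L → ℝ := fun k => Real.exp (-(β * twistedBand L ![0, 0] 0 k)) with hκ
  have hκ0 : ∀ k, 0 < κ k := fun k => Real.exp_pos _
  have hup := Inputs.offArcGaussianDecay_holds (TorusSite 2 L) (fun k => r * κ k) φ fun k => mul_pos hr (hκ0 k)
  have hdn := Inputs.offArcGaussianDecay_holds (TorusSite 2 L) (fun k => r' * κ k) ψ fun k => mul_pos hr' (hκ0 k)
  have e1 : ∏ k : TorusSite 2 L, (1 + (r : ℂ) * Complex.exp (Complex.I * φ) * ((κ k : ℝ) : ℂ)) =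
      ∏ k : TorusSite 2 L, (1 + ((r * κ k : ℝ) : ℂ) * Complex.exp (Complex.I * φ)) :=
    Finset.prod_congr rfl fun k _ => by push_cast; ring
  have e2 : ∏ k : TorusSite 2 L, (1 + (r' : ℂ) * Complex.exp (Complex.I * ψ) * ((κ k : ℝ) : ℂ)) =
      ∏ k : TorusSite 2 L, (1 + ((r' * κ k : ℝ) : ℂ) * Complex.exp (Complex.I * ψ)) :=
    Finset.prod_congr rfl fun k _ => by push_cast; ring
  rw [e1, e2]
  exact mul_le_mul hup hdn (norm_nonneg _) (by positivity)

end Summit.Ventures.CertifiedManyBodySolver.Theorems.TcThermcert1.FreeCanonicalB8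

end
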